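import Summits.AtomisticToContinuum.Crystallization.Theses.ChessboardParticlePlanes
import Summits.AtomisticToContinuum.Crystallization.Theorems.ChessboardParticlePlanesLjBilayerHcpStubPresentation
import Summits.AtomisticToContinuum.Crystallization.Theorems.ChessboardParticlePlanesLjBilayerHcpStubNormalForm

/-!
# Crux `ChessboardParticlePlanes.LjBilayerHcp` (stmt-AtomisticToContinuum-6710), line `Sketch` —
# the crux is EQUIVALENT to its restriction to normal presentations

The crux `Summit.AtomisticToContinuum.Crystallization.Theses.ChessboardParticlePlanes.LjBilayerHcp` quantifies over all
`2/3`-separated PERIOD-2 STACKS `B` (points on the planes `x₂ ∈ t + cℤ`, `c ≥ 3/4`, point set invariant under `± 2c e₃`),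
presented by an arbitrary lattice of periods and motif.  This file records, as an importable `iff`, the loss-free
bookkeeping half of line `Sketch` (stubs `stub_presentation` p102865 and `stub_normalForm` p104663, WITHOUT the
half-phantom split of `stub_oneLayer`): it is enough — and of course necessary — to compare `hcp(a, h)` with the
`2/3`-separated NORMAL presentations, i.e. periodic configurations `B` with

* `2c e₃ ∈ B.lattice` (the vertical period is a period of the presentation),
* every period has height in `2cℤ` (so `B.lattice = Λ₀ ⊕ ℤ·2c e₃` with `Λ₀` planar: the ROD PICTURE),
* every point has height in `cℤ` (base height `t = 0`).

`ljBilayerHcp_iff_normalForm : LjBilayerHcp ↔ (∃ (a,h) ∈ box, ∀ c ≥ 3/4, ∀ normal 2/3-separated B, e(hcp a h) ≤ e(B))`.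
Any future line for this crux (Euler/hole census, LP slab pair, epitaxy) may start from the right-hand side; the
species-wise splitting of `∑_{x ∈ F} ε_x` for such presentations is `stub_energyIdentity` (p106374).

Proof: `→` is the inclusion of classes (a normal presentation is a period-2 stack with `t = 0`, invariance under
`± 2c e₃` from `PeriodicConfiguration.add_mem_points`); `←` translates by `-t e₃`, re-presents with `stub_normalForm`
and transports the energy per particle with `stub_presentation` and the separation with `dist_add_right`.
-/

noncomputable section

open scoped BigOperators Classical
open Literature.MathematicalPhysics.StatisticalMechanics

namespace Summit.AtomisticToContinuum.Crystallization.Theorems.LjBilayerHcpSketch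

/-- **Normal form suffices.** If some `hcp(a, h)` with `(a, h)` in the box `[47/50, 1] × [39a/50, 17a/20]` has
Lennard-Jones energy per particle `≤` that of every `2/3`-separated NORMAL presentation (`2c e₃ ∈ B.lattice`, periods
with heights in `2cℤ`, points with heights in `cℤ`, `c ≥ 3/4`), then the crux `LjBilayerHcp` holds: translate a
period-2 stack by `-t e₃`, re-present it in normal form (`stub_normalForm`, p104663) and use that the energy per
particle depends only on the point set up to translation (`stub_presentation`, p102865). [folklore] -/
theorem ljBilayerHcp_of_normalForm
    (H : ∃ a h : ℝ, ∃ (ha : a ≠ 0) (hh : h ≠ 0), 47 / 50 ≤ a ∧ a ≤ 1 ∧ 39 / 50 * a ≤ h ∧ h ≤ 17 / 20 * a ∧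
      ∀ c : ℝ, 3 / 4 ≤ c → ∀ B : PeriodicConfiguration 3,
        (∀ x ∈ B.points, ∀ y ∈ B.points, x ≠ y → (2 : ℝ) / 3 ≤ dist x y) →
        (2 * c) • EuclideanSpace.single (2 : Fin 3) (1 : ℝ) ∈ B.lattice →
        (∀ g ∈ B.lattice, ∃ k : ℤ, g 2 = 2 * c * (k : ℝ)) →
        (∀ x ∈ B.points, ∃ k : ℤ, x 2 = c * (k : ℝ)) →
        (hcpPeriodicConfiguration ha hh).energyPerParticle lennardJones ≤ B.energyPerParticle lennardJones) :
    Summit.AtomisticToContinuum.Crystallization.Theses.ChessboardParticlePlanes.LjBilayerHcp := by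
  obtain ⟨a, h, ha, hh, b1, b2, b3, b4, H⟩ := H
  refine ⟨a, h, ha, hh, b1, b2, b3, b4, fun B hsep hstack => ?_⟩
  obtain ⟨t, c, hc, hpl, hinv⟩ := hstack
  have hc0 : c ≠ 0 := by linarith
  obtain ⟨B', h2c, hL, hpts⟩ := stub_normalForm B t c hc0 hpl hinv
  have hmem : ∀ x ∈ B'.points, x + t • EuclideanSpace.single (2 : Fin 3) (1 : ℝ) ∈ B.points := by
    intro x hx
    rw [hpts]
    exact ⟨x, hx, rfl⟩
  have hsep' : ∀ x ∈ B'.points, ∀ y ∈ B'.points, x ≠ y → (2 : ℝ) / 3 ≤ dist x y := by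
    intro x hx y hy hxy
    have key := hsep _ (hmem x hx) _ (hmem y hy) (fun hxy' => hxy (add_right_cancel hxy'))
    rwa [dist_add_right] at key
  have hpts' : ∀ x ∈ B'.points, ∃ k : ℤ, x 2 = c * (k : ℝ) := by
    intro x hx
    obtain ⟨k, hk⟩ := hpl _ (hmem x hx)
    have h2 : (x + t • EuclideanSpace.single (2 : Fin 3) (1 : ℝ)) 2 = x 2 + t := by simp
    exact ⟨k, by linarith⟩
  have key := H c hc B' hsep' h2c hL hpts'
  rwa [stub_presentation lennardJones B B' (t • EuclideanSpace.single (2 : Fin 3) (1 : ℝ)) hpts]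

/-- **Normal presentations are period-2 stacks.** Conversely, the crux `LjBilayerHcp` implies its restriction to
`2/3`-separated normal presentations: such a `B` is a period-2 stack with base height `t = 0` and spacing `c`
(its points have heights in `cℤ`, and `x ± 2c e₃ ∈ B.points` because `2c e₃` is a period,
`PeriodicConfiguration.add_mem_points`). The hypothesis on the heights of the periods is not even needed. [folklore] -/
theorem normalForm_of_ljBilayerHcp
    (H : Summit.AtomisticToContinuum.Crystallization.Theses.ChessboardParticlePlanes.LjBilayerHcp) :
    ∃ a h : ℝ, ∃ (ha : a ≠ 0) (hh : h ≠ 0), 47 / 50 ≤ a ∧ a ≤ 1 ∧ 39 / 50 * a ≤ h ∧ h ≤ 17 / 20 * a ∧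
      ∀ c : ℝ, 3 / 4 ≤ c → ∀ B : PeriodicConfiguration 3,
        (∀ x ∈ B.points, ∀ y ∈ B.points, x ≠ y → (2 : ℝ) / 3 ≤ dist x y) →
        (2 * c) • EuclideanSpace.single (2 : Fin 3) (1 : ℝ) ∈ B.lattice →
        (∀ g ∈ B.lattice, ∃ k : ℤ, g 2 = 2 * c * (k : ℝ)) →
        (∀ x ∈ B.points, ∃ k : ℤ, x 2 = c * (k : ℝ)) →
        (hcpPeriodicConfiguration ha hh).energyPerParticle lennardJones ≤ B.energyPerParticle lennardJones := by
  obtain ⟨a, h, ha, hh, b1, b2, b3, b4, H⟩ := H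
  refine ⟨a, h, ha, hh, b1, b2, b3, b4, fun c hc B hsep h2c _ hpts => H B hsep ⟨0, c, hc, ?_, ?_⟩⟩
  · intro x hx
    obtain ⟨k, hk⟩ := hpts x hx
    exact ⟨k, by rw [hk]; ring⟩
  · intro x hx
    refine ⟨B.add_mem_points hx h2c, ?_⟩
    rw [sub_eq_add_neg]
    exact B.add_mem_points hx (B.lattice.neg_mem h2c)

/-- **The crux is equivalent to its normal-form restriction**: `LjBilayerHcp ↔` "some `hcp(a, h)` with `(a, h)` in the
box has Lennard-Jones energy per particle `≤` that of every `2/3`-separated periodic configuration whose lattice of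
periods contains `2c e₃` and has heights in `2cℤ` and whose points have heights in `cℤ`, for every `c ≥ 3/4`"
(the rod picture: two planar species at even / odd multiples of `c`, common planar period lattice). [folklore] -/
theorem ljBilayerHcp_iff_normalForm :
    Summit.AtomisticToContinuum.Crystallization.Theses.ChessboardParticlePlanes.LjBilayerHcp ↔
    ∃ a h : ℝ, ∃ (ha : a ≠ 0) (hh : h ≠ 0), 47 / 50 ≤ a ∧ a ≤ 1 ∧ 39 / 50 * a ≤ h ∧ h ≤ 17 / 20 * a ∧
      ∀ c : ℝ, 3 / 4 ≤ c → ∀ B : PeriodicConfiguration 3,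
        (∀ x ∈ B.points, ∀ y ∈ B.points, x ≠ y → (2 : ℝ) / 3 ≤ dist x y) →
        (2 * c) • EuclideanSpace.single (2 : Fin 3) (1 : ℝ) ∈ B.lattice →
        (∀ g ∈ B.lattice, ∃ k : ℤ, g 2 = 2 * c * (k : ℝ)) →
        (∀ x ∈ B.points, ∃ k : ℤ, x 2 = c * (k : ℝ)) →
        (hcpPeriodicConfiguration ha hh).energyPerParticle lennardJones ≤ B.energyPerParticle lennardJones :=
  ⟨normalForm_of_ljBilayerHcp, ljBilayerHcp_of_normalForm⟩

end Summit.AtomisticToContinuum.Crystallization.Theorems.LjBilayerHcpSketch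

end
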